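import Literature.AnabelianGeometry.EtaleTheta.Discharge.Sec2MonodromyModelDottedMembers
import Literature.AnabelianGeometry.EtaleTheta.ThetaCoversMonodromyModelSheet
import HarnessLib

/-!
# The UNDOTTED members `Π^tp_{X̲̲}, Π^tp_{X̲}, Π^tp_{C̲̲}, Π^tp_{C̲}` and `Π^tp_Ÿ` of the monodromy model in coordinates:
# stabilisation by the automorphism family and the sheet twists; the members as images of `embCuE` ([EtTh] §2, Prop. 2.4)

S. Mochizuki, *The étale theta function and its Frobenioid-theoretic manifestations* [EtTh], Publ. RIMS **45**
(2009), §2 Prop. 2.4 (PDF p. 38: automorphisms of `Π^tp_{X̲̲}` (resp. `X̲`, `C̲̲`, `C̲`) are compatible with the `Π^tp`'s of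
`X̲̲, X̲, X, C̲̲, C̲, C, Ÿ`), Rmk. 2.6.1 (p. 40) [cite: MochizukiEtTh2009, Prop 2.4 p.38] [cite: MochizukiEtTh2009, Rmk 2.6.1 p.40].
Cell abc-iut, layer L2, seat abc-iut-w6-d084 (gen 7), «P26-NV MONODROMY TOY» STAGE 2b (abc-iut-L2-lead R1352).
PROOF-ONLY companion of `ThetaCoversMonodromyModelAut.lean` / `ThetaCoversMonodromyModelSheet.lean`
(no definition, no named fact; nothing of [EtTh] asserted).

HONEST LABEL (R1352): a DESIGNED tempered toy with print's monodromy combinatorics; `G_K := 1`; NOT a Tate curve, NOT the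
tempered fundamental group of a curve; consistency ≠ faithfulness; nothing here takes a side on anything printed.

CONTENT (coordinates `(b, c, d, e)` on `TG l`).  §1 `Π^tp_Ÿ = {d = 1, e = 1}` is stabilised by `scaleAut u`, `halfShift k`,
`conj(ι)`, `conj(x^a)`; the sheet twists `sheetTwist (χ' ∘ pr_{D_∞})` (`e ↦ e · χ'(d)`) stabilise every coordinate member
`PhiT⁻¹(A)` and `Π^tp_Ÿ`.  §2 The generators on `embCuE ((c, d), e)`.  §3 Membership forms: `Π^tp_{C̲} = embCuE(everything)`,
`Π^tp_{C̲̲} = embCuE(1 × D_∞ × ℤ/2)`, `Π^tp_{X̲} = embCuE(ℤ/l × ⟨r⟩ × ℤ/2)`, `Π^tp_{X̲̲} = embCuE(1 × ⟨r⟩ × ℤ/2)` — the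
undotted members are the dotted ones times the sheet `⟨e⟩` (Rmk. 2.6.1).  Sequel: `Discharge/Sec2Prop24TrueAtMonodromyModel.lean`.
-/

noncomputable section

namespace Literature.AnabelianGeometry.EtaleTheta.ThetaCovers.MonodromyModel

open Multiplicative HeisenbergWitness TemperedModel DihedralGroup
open KummerWitness (map_equiv_eq_of_iff)

variable (l : ℕ)

/-! ## 1. `Π^tp_Ÿ` and the sheet twists -/

/-- Membership in `Π^tp_Ÿ = {d = 1, e = 1}`. (toy bookkeeping for [EtTh] Def. 2.5 «`Π^tp_Ÿ`»; no claim about print)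
[cite: MochizukiEtTh2009, Def 2.5 p.39] -/
theorem mem_PiYddT_iff (g : TG l) : g ∈ PiYddT l ↔ g.1.right = 1 ∧ g.2 = 1 := by
  rw [Subgroup.mem_inf, mem_PiYT, MonoidHom.mem_ker]
  rfl

/-- `scaleAut u`, `halfShift k`, `conj(ι)` and `conj(x^a)` stabilise `Π^tp_Ÿ`. (toy bookkeeping for [EtTh] Prop. 2.4
«compatible with `Π^tp_Ÿ`»; no claim about print) [cite: MochizukiEtTh2009, Prop 2.4 p.38] -/
theorem stabilise_PiYddT (hl : Odd l) (u : (ZMod l)ˣ) (k : ZMod 0) (a : ZMod l) :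
    (PiYddT l).map (scaleAut l u).toMonoidHom = PiYddT l ∧
      (PiYddT l).map (halfShift l hl k).toMonoidHom = PiYddT l ∧
      (PiYddT l).map (MulAut.conj (iotaT l)).toMonoidHom = PiYddT l ∧
      (PiYddT l).map (MulAut.conj (xElt l a)).toMonoidHom = PiYddT l := by
  refine ⟨map_equiv_eq_of_iff _ _ fun g => ?_, map_equiv_eq_of_iff _ _ fun g => ?_,
    map_equiv_eq_of_iff _ _ fun g => ?_, map_equiv_eq_of_iff _ _ fun g => ?_⟩
  · rw [mem_PiYddT_iff, mem_PiYddT_iff, (scaleAut_coords l u g).1, (scaleAut_coords l u g).2.2.2]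
  · rw [mem_PiYddT_iff, mem_PiYddT_iff, (halfShift_coords l hl k g).1, (halfShift_coords l hl k g).2.2.2]
    rcases g.1.right with j | j
    · rw [dihedralShift_r]
    · rw [dihedralShift_sr, one_def]
      constructor <;> rintro ⟨h, _⟩ <;> cases h
  · rw [mem_PiYddT_iff, mem_PiYddT_iff, (conj_iotaT_coords l g).1, (conj_iotaT_coords l g).2.2.2]
    rcases g.1.right with j | j
    · rw [(sr_conj_dihedral j).1, one_def]
      constructor
      · rintro ⟨h, he⟩
        have h' : (-j : ZMod 0) = 0 := by injection h
        exact ⟨by rw [neg_eq_zero.mp h'], he⟩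
      · rintro ⟨h, he⟩
        have h' : (j : ZMod 0) = 0 := by injection h
        exact ⟨by rw [h', neg_zero], he⟩
    · rw [(sr_conj_dihedral j).2, one_def]
      constructor <;> rintro ⟨h, _⟩ <;> cases h
  · rw [mem_PiYddT_iff, mem_PiYddT_iff, (conj_xElt_coords l a g).1, (conj_xElt_coords l a g).2.2.2]

/-- A sheet twist by a character of `D_∞` (`e ↦ e · χ'(d)`) stabilises every coordinate member `PhiT⁻¹(A)` (it does not
move `(b, c, d)`) and `Π^tp_Ÿ` (`χ'(1) = 1`). (toy bookkeeping for [EtTh] Prop. 2.4; no claim about print)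
[cite: MochizukiEtTh2009, Prop 2.4 p.38] -/
theorem sheetTwist_stabilises (χ' : DihedralGroup 0 →* Multiplicative (ZMod 2)) (A : Subgroup (heisPiC l)) :
    (A.comap (PhiT l)).map (sheetTwist l (χ'.comp SemidirectProduct.rightHom)).toMonoidHom = A.comap (PhiT l) ∧
      (PiYddT l).map (sheetTwist l (χ'.comp SemidirectProduct.rightHom)).toMonoidHom = PiYddT l := by
  refine ⟨map_equiv_eq_of_iff _ _ fun g => Iff.rfl, map_equiv_eq_of_iff _ _ fun g => ?_⟩
  rw [mem_PiYddT_iff, mem_PiYddT_iff, (sheetTwist_coords l _ g).1, (sheetTwist_coords l _ g).2.2.2,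
    MonoidHom.comp_apply, SemidirectProduct.rightHom_eq_right]
  constructor
  · rintro ⟨h1, h2⟩
    refine ⟨h1, ?_⟩
    rwa [show g.1.right = 1 from h1, map_one, mul_one] at h2
  · rintro ⟨h1, h2⟩
    refine ⟨h1, ?_⟩
    rw [show g.1.right = 1 from h1, map_one, mul_one, h2]

/-! ## 2. The generators on `embCuE ((c, d), e)` -/

/-- `scaleAut u`, `halfShift k`, `conj(ι)` and the sheet twists on `embCuE ((c, d), e)`: `c ↦ u c`; `d ↦ shift_k d`;
`d ↦ s d s`; `e ↦ e χ'(d)`. (toy bookkeeping for [EtTh] Rmk. 2.6.1; no claim about print) [cite: MochizukiEtTh2009, Rmk 2.6.1 p.40] -/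
theorem generators_embCuE (hl : Odd l) (u : (ZMod l)ˣ) (k : ZMod 0) (χ' : DihedralGroup 0 →* Multiplicative (ZMod 2))
    (c : Multiplicative (ZMod l)) (d : DihedralGroup 0) (ε : Multiplicative (ZMod 2)) :
    scaleAut l u (embCuE l ((c, d), ε)) = embCuE l ((ofAdd ((u : ZMod l) * toAdd c), d), ε) ∧
      halfShift l hl k (embCuE l ((c, d), ε)) = embCuE l ((c, dihedralShift k d), ε) ∧
      MulAut.conj (iotaT l) (embCuE l ((c, d), ε)) = embCuE l ((c, sr 0 * d * sr 0), ε) ∧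
      sheetTwist l (χ'.comp SemidirectProduct.rightHom) (embCuE l ((c, d), ε)) = embCuE l ((c, d), ε * χ' d) := by
  refine ⟨?_, ?_, ?_, ?_⟩
  · refine TG.ext l (scaleAut_coords l u _).1 ?_ ?_ (scaleAut_coords l u _).2.2.2
    · rw [(scaleAut_coords l u _).2.1, (embCuE_coords l _).2.1, (embCuE_coords l _).2.1, mul_zero]
    · rw [(scaleAut_coords l u _).2.2.1, (embCuE_coords l _).2.2.1, (embCuE_coords l _).2.2.1, toAdd_ofAdd]
  · refine TG.ext l (halfShift_coords l hl k _).1 ?_ ?_ (halfShift_coords l hl k _).2.2.2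
    · rw [(halfShift_coords l hl k _).2.1, (embCuE_coords l _).2.1, (embCuE_coords l _).2.1]
    · rw [(halfShift_coords l hl k _).2.2.1, (embCuE_coords l _).2.1, mul_zero, add_zero, (embCuE_coords l _).2.2.1,
        (embCuE_coords l _).2.2.1]
  · refine TG.ext l (conj_iotaT_coords l _).1 ?_ (conj_iotaT_coords l _).2.2.1 (conj_iotaT_coords l _).2.2.2
    rw [(conj_iotaT_coords l _).2.1, (embCuE_coords l _).2.1, (embCuE_coords l _).2.1, neg_zero]
  · refine TG.ext l rfl rfl rfl ?_
    rw [(sheetTwist_coords l _ _).2.2.2, (embCuE_coords l _).2.2.2, (embCuE_coords l _).2.2.2, MonoidHom.comp_apply,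
      SemidirectProduct.rightHom_eq_right, (embCuE_coords l _).1]

/-- `conj(x^a)` on `embCuE ((c, r^i), e)`: the twist `c ↦ c − i a`. (toy bookkeeping for [EtTh] Prop. 2.4; no claim about
print) [cite: MochizukiEtTh2009, Prop 2.4 p.38] -/
theorem conj_xElt_embCuE_r (a c : ZMod l) (i : ZMod 0) (ε : Multiplicative (ZMod 2)) :
    MulAut.conj (xElt l a) (embCuE l ((ofAdd c, r i), ε)) =
      embCuE l ((ofAdd (c - ZMod.castHom (dvd_zero l) (ZMod l) i * a), r i), ε) := by
  refine TG.ext l (conj_xElt_coords l a _).1 ?_ ?_ (conj_xElt_coords l a _).2.2.2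
  · rw [(conj_xElt_coords l a _).2.1, (embCuE_coords l _).2.1, (embCuE_coords l _).2.1, (embCuE_coords l _).1]
    change 0 + a * (1 - eps l (dihedralRed l (r i))) = 0
    rw [dihedralRed_r, eps_r, sub_self, mul_zero, add_zero]
  · rw [(conj_xElt_coords l a _).2.2.1, (embCuE_coords l _).2.2.1, (embCuE_coords l _).2.2.1, (embCuE_coords l _).1,
      toAdd_ofAdd, toAdd_ofAdd]
    change c - rotIdx l (dihedralRed l (r i)) * a = _
    rw [dihedralRed_r, rotIdx_r]

/-! ## 3. Membership forms of the undotted members -/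

/-- **The undotted members as images of `embCuE`**: `Π^tp_{C̲} = {b = 0}`, `Π^tp_{C̲̲} = {b = c = 0}`,
`Π^tp_{X̲} = {b = 0, d rotation}`, `Π^tp_{X̲̲} = {b = c = 0, d rotation}`. (toy bookkeeping for [EtTh] Prop. 2.4 /
Rmk. 2.6.1; no claim about print) [cite: MochizukiEtTh2009, Rmk 2.6.1 p.40] -/
theorem mem_undotted_iff (g : TG l) :
    (g ∈ (heisB0 l).comap (PhiT l) ↔ ∃ q, g = embCuE l q) ∧
      (g ∈ (heisD l).comap (PhiT l) ↔ ∃ (d : DihedralGroup 0) (ε : Multiplicative (ZMod 2)), g = embCuE l ((1, d), ε)) ∧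
      (g ∈ (heisB0 l ⊓ heisPiX l).comap (PhiT l) ↔
        ∃ (c : ZMod l) (j : ZMod 0) (ε : Multiplicative (ZMod 2)), g = embCuE l ((ofAdd c, r j), ε)) ∧
      (g ∈ (heisD l ⊓ heisPiX l).comap (PhiT l) ↔
        ∃ (j : ZMod 0) (ε : Multiplicative (ZMod 2)), g = embCuE l ((1, r j), ε)) := by
  refine ⟨?_, ?_, ?_, ?_⟩
  · rw [(mem_members_iff l g).1]
    constructor
    · intro hb; exact ⟨_, eq_embCuE_of_bC l hb⟩
    · rintro ⟨q, rfl⟩; exact (embCuE_coords l q).2.1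
  · rw [(mem_members_iff l g).2.1]
    constructor
    · rintro ⟨hb, hc⟩
      refine ⟨g.1.right, g.2, ?_⟩
      conv_lhs => rw [eq_embCuE_of_bC l hb, hc]
      rfl
    · rintro ⟨d, ε, rfl⟩; exact ⟨(embCuE_coords l _).2.1, (embCuE_coords l _).2.2.1⟩
  · rw [Subgroup.comap_inf, Subgroup.mem_inf, (mem_members_iff l g).1, (mem_members_iff l g).2.2.1]
    constructor
    · rintro ⟨hb, j, hj⟩
      refine ⟨cC l g, j, g.2, ?_⟩
      conv_lhs => rw [eq_embCuE_of_bC l hb, hj]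
    · rintro ⟨c, j, ε, rfl⟩
      exact ⟨(embCuE_coords l _).2.1, j, (embCuE_coords l _).1⟩
  · rw [Subgroup.comap_inf, Subgroup.mem_inf, (mem_members_iff l g).2.1, (mem_members_iff l g).2.2.1]
    constructor
    · rintro ⟨⟨hb, hc⟩, j, hj⟩
      refine ⟨j, g.2, ?_⟩
      conv_lhs => rw [eq_embCuE_of_bC l hb, hc, hj]
      rfl
    · rintro ⟨j, ε, rfl⟩
      exact ⟨⟨(embCuE_coords l _).2.1, (embCuE_coords l _).2.2.1⟩, j, (embCuE_coords l _).1⟩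

end Literature.AnabelianGeometry.EtaleTheta.ThetaCovers.MonodromyModel

end
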